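import Summits.CriticalPhenomena.PercolationContinuityZ3.Theses.PercAnnulusCrossing
import Summits.CriticalPhenomena.PercolationContinuityZ3.Theorems.PercNonProliferationSubpolynomialBlockingStubBlockerRSWGlue
import HarnessLib

/-!
# Crux `PercNonProliferation.SubpolynomialBlocking` (stmt-CriticalPhenomena-4446), line `cross-sandwich-flat-seal` — stub `stub_anchorOfCubeBlockingSeed`

Helper file for the lead's skeleton of the line `cross-sandwich-flat-seal` of the crux
`Summit.CriticalPhenomena.PercolationContinuityZ3.Theses.PercNonProliferation.SubpolynomialBlocking`.
Proves exactly the registered stub signature `stub_anchorOfCubeBlockingSeed`; lands with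
`--supports stmt-CriticalPhenomena-4446`.

Write `q_n = P_{p_c}(seal₀([0,n]³))` for the probability, at `p = p_c(ℤ³)`, that NO open path inside the
cube `[0,n]³` joins its face `{x₀ = 0}` to its face `{x₀ = n}`. The open stub `stub_anchor` of the line
asks `q_n ≥ n^{-s}` eventually, for every `s > 0`. The sibling route item
`PercAnnulusCrossing.CubeBlockingSeed` (stmt-CriticalPhenomena-1141, open) asserts the stronger uniform
bound `∃ c > 0, ∀ n ≥ 1, c ≤ q_n` (in a `Finset.Icc`/`openConnIn` spelling). This file records the
trivial edge `CubeBlockingSeed → stub_anchor`: `n^{-s} → 0`, so eventually `n^{-s} < c ≤ q_n`; the two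
spellings of the seal event agree by the landed `StubBlockerRSWGlue.sealEvent_eq` (p121157).

No new definitions; no unproved facts are used (the seed is a HYPOTHESIS).
-/

noncomputable section

namespace Summit.CriticalPhenomena.PercolationContinuityZ3.Theorems.SubpolynomialBlocking

open MeasureTheory Filter Topology
open Literature.Probability.Percolation Literature.Probability.LatticeModels
open Summit.CriticalPhenomena.PercolationContinuityZ3.Theses

/-- **Stub `stub_anchorOfCubeBlockingSeed`** (registered signature): the critical cube-blocking seed
`∃ c > 0, ∀ n ≥ 1, c ≤ q_n` (body of the sibling item `PercAnnulusCrossing.CubeBlockingSeed`, with the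
`Literature.…` prefixes opened) implies the line's open stub `stub_anchor`: for every `s > 0`,
eventually `n^{-s} ≤ q_n`. Proof: `n^{-s} → 0 < c` (`tendsto_rpow_neg_atTop`), and the `Finset.Icc`
seal event of the hypothesis is the complement of the `openCrossing` event of the conclusion
(`StubBlockerRSWGlue.sealEvent_eq`). -/
theorem stub_anchorOfCubeBlockingSeed : (∃ c : ℝ, 0 < c ∧ ∀ n : ℕ, 1 ≤ n → c ≤ (bondPercolation (zdGraph 3) (criticalProbI 3)).real {ω | ¬ ∃ x ∈ Finset.Icc (0 : Site 3) ![(n : ℤ), n, n], ∃ y ∈ Finset.Icc (0 : Site 3) ![(n : ℤ), n, n], x 0 = 0 ∧ y 0 = n ∧ ω ∈ openConnIn ↑(Finset.Icc (0 : Site 3) ![(n : ℤ), n, n]) x y}) → ∀ s : ℝ, 0 < s → ∀ᶠ n : ℕ in atTop, (n : ℝ) ^ (-s) ≤ (bondPercolation (zdGraph 3) (criticalProbI 3)).real (openCrossing (Set.Icc (0 : Site 3) ![(n : ℤ), (n : ℤ), (n : ℤ)]) {x | x ∈ Set.Icc (0 : Site 3) ![(n : ℤ), (n : ℤ), (n :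 ℤ)] ∧ x 0 = 0} {y | y ∈ Set.Icc (0 : Site 3) ![(n : ℤ), (n : ℤ), (n : ℤ)] ∧ y 0 = (n : ℤ)})ᶜ := by
  rintro ⟨c, hc, hseed⟩ s hs
  -- `n^{-s} → 0`, hence eventually `n^{-s} < c`
  have hB : ∀ᶠ n : ℕ in atTop, (n : ℝ) ^ (-s) < c :=
    ((tendsto_rpow_neg_atTop hs).comp tendsto_natCast_atTop_atTop).eventually (gt_mem_nhds hc)
  filter_upwards [hB, eventually_ge_atTop 1] with n hB hn
  -- the conclusion's event is the hypothesis' seal event (same set, two spellings)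
  rw [← StubBlockerRSWGlue.sealEvent_eq]
  exact hB.le.trans (hseed n hn)

namespace StubAnchorOfCubeBlockingSeed

/-- The stub read through the sibling route's item name: `PercAnnulusCrossing.CubeBlockingSeed`
(stmt-CriticalPhenomena-1141) implies the line's stub `stub_anchor` (`q_n ≥ n^{-s}` eventually, every
`s > 0`). The item is a `def` whose body is the hypothesis of `stub_anchorOfCubeBlockingSeed` verbatim.
This file is a helper of crux stmt-CriticalPhenomena-4446, not a closure of the sibling item. -/
theorem anchor_of_cubeBlockingSeed (h : PercAnnulusCrossing.CubeBlockingSeed) :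
    ∀ s : ℝ, 0 < s → ∀ᶠ n : ℕ in atTop,
      (n : ℝ) ^ (-s) ≤
        (bondPercolation (zdGraph 3) (criticalProbI 3)).real
          (openCrossing (Set.Icc (0 : Site 3) ![(n : ℤ), (n : ℤ), (n : ℤ)])
            {x | x ∈ Set.Icc (0 : Site 3) ![(n : ℤ), (n : ℤ), (n : ℤ)] ∧ x 0 = 0}
            {y | y ∈ Set.Icc (0 : Site 3) ![(n : ℤ), (n : ℤ), (n : ℤ)] ∧ y 0 = (n : ℤ)})ᶜ :=
  stub_anchorOfCubeBlockingSeed h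

end StubAnchorOfCubeBlockingSeed

end Summit.CriticalPhenomena.PercolationContinuityZ3.Theorems.SubpolynomialBlocking

end
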